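import Literature.NumberTheory.Sieve.VaughanMeanValueDecomposition
import Literature.NumberTheory.Sieve.DivisorBound
import HarnessLib

/-!
# Friedlander–Iwaniec, *The polynomial `X² + Y⁴` captures its primes*, §26: the engine of Theorem 2^ψ — sums `Σ Λ(n) λ(n)` from type-I and type-II information by Vaughan's identity

Family `parity`, statement parity.S17 (`setOf_prime_sq_add_pow_four_infinite`). Source: J. Friedlander,
H. Iwaniec, Ann. of Math. (2) 148 (1998), 945–1040 [FriedlanderIwaniecAnnals1998], §26 "Proof of
Theorem 2^ψ" (arXiv math/9811185, pp. 85–86): "By (23.2) it suffices to show that [(26.1)]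
`S(χ) = Σ_{|z|² ≤ x} Λ(z) [z] χ(z) ψ(z) ≪ d(|k|+1) x^{76/77}` … Putting `λ(ℓ) = Σ_{χ∈S} Σ_{|z|²=ℓ} [z] χ(z) ψ(z)`
we can write [(26.2)] `S(ψ) = Σ_{ℓ ≤ x} Λ(ℓ) λ(ℓ)`. Next we apply a formula of Vaughan's type [(26.3)] …
From the linear terms we get linear forms in `λ(ℓ)` and from the quadratic terms we get bilinear forms
in `λ(ℓ)`. The latter ones, `L(M, N)`, have bounded coefficients and are of type which we have treated
in Proposition 23.1 (apply partial summation to replace `log a` by `1` …). The linear forms can be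
treated as bilinear ones … unless the other variable is quite long in which case it is better to
apply Proposition 23.2. … Alternatively, one can apply the argument used in Section 25 which consists
of splitting into short interval summation so that the separation of variables is not compromised
too much (it is cruder but sufficient)."

This file PROVES that deduction once, for an arbitrary complex sequence `λ`, with the two analytic
inputs as explicit hypotheses in the shape delivered by Propositions 23.2 (type I) and 23.1 (type II)
of the source, and with an explicit (non-optimised) power saving `x^{1 - 1/1000}` in place of the
printed `x^{76/77}` (any power saving serves Proposition 17.2 / (17.15)). No named facts. The
application to the `λ(ℓ)` of (26.2) — i.e. Theorem 2^ψ itself — waits for §23 of the source in the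
tree.

## Contents

* Hypotheses (definitions, `Prop`-valued with parameters): `TypeIBound λ W`
  (`‖Σ_{n ≤ N} λ(dn)‖ ≤ W d N^{4/5}`, the shape of Proposition 23.2 after `τ(d)⁴ d^{1/2} log ≪ d`,
  `N^{3/4} log N ≪ N^{4/5}`), `TypeIIBound λ W` (`‖ΣΣ_{m≤M, n≤N} α(m)β(n)λ(mn)‖ ≤ W (M+N)^{1/12} (MN)^{11/12+η}`
  for `|α|, |β| ≤ 1`, the shape of Proposition 23.1 for `L(M, N)` at `ε = η = 10⁻⁴`, `eta`),
  `PointwiseBound λ B` (`|λ(n)| ≤ B τ(n)`).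
* Tools: `sum_mul_conv_eq` (`Σ_{n≤x} (f*g)(n) λ(n) = Σ_d f(d) Σ_{m ≤ x/d} g(m) λ(dm)`), `norm_sum_log_mul_le`
  (Abel summation: partial sums `≤ F` ⇒ `‖Σ (log m) a_m‖ ≤ 2F log X`, the "partial summation to
  replace `log a` by `1`"), `norm_bilinear_le` (scaling of the type-II hypothesis to coefficients
  bounded by `A`, `B'`).
* The four pieces of Vaughan's identity `Λ = Λ_{≤U} + μ_{≤U}*log − c_U*1 + F_U*G_U`
  (`Vaughan.vonMangoldt_eq_four_terms` of the tree): `norm_sum_vonMangoldtTrunc_le` (`≤ B U³`),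
  `norm_sum_moebiusTrunc_log_le` (`≤ 2W x^{4/5} U^{6/5} log x`), `norm_sum_cU_zeta_le`
  (`≤ 2W x^{4/5} U^{12/5} log U`), and the type-II piece `norm_sum_fU_gU_le` through
  `norm_shortInterval_le` (a short interval of `d`: rectangle by the type-II bound plus boundary
  strips by the trivial bound), `norm_block_le` (a dyadic block cut into `K` short intervals; the
  strip widths telescope) — the source's "cruder but sufficient" separation of `dm ≤ x`.
* `norm_sum_vonMangoldt_mul_le_param` (all four pieces, free parameters `U, K, J, T`) and the
  **engine** `exists_norm_sum_vonMangoldt_mul_le`: an absolute `C` with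
  `‖Σ_{n ≤ x} Λ(n) λ(n)‖ ≤ C (W + B) x^{1 − 1/1000}` for all `x ≥ 1` and all `λ, W, B` satisfying the
  three hypotheses (choices `U = ⌊x^{1/14}⌋`, `K = ⌈U^{1/24}⌉`, the divisor bound `τ(n) ≪ n^{1/2000}`
  of `Sieve.exists_card_divisors_le_mul_rpow`).

## References

* J. Friedlander, H. Iwaniec, Ann. of Math. (2) 148 (1998), 945–1040, §26, (26.1)–(26.3); Propositions
  23.1, 23.2 for the shape of the hypotheses. [FriedlanderIwaniecAnnals1998]
* R. C. Vaughan, Acta Arith. 37 (1980), 111–115 (the identity; tree file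
  `VaughanMeanValueDecomposition`). [Vaughan1980]

## Tree / Mathlib

Tree: `Vaughan.vonMangoldt_eq_four_terms`, `Vaughan.cU/gU/fU` with `abs_cU_le_log`,
`cU_eq_zero_of_lt`, `gU_eq_zero_of_le`, `abs_gU_le`, `fU_apply`, `Vaughan.sum_Ioc_sum_divisorsAntidiagonal_eq`,
`Vaughan.log_eq_sum_Ioc_sub`, `Vaughan.sum_Ioc_mul_two_pow_eq_sum` (`VaughanMeanValueDecomposition`);
`Sieve.moebiusTrunc`, `Sieve.vonMangoldtTrunc` (`CircleMethod`); `Sieve.exists_card_divisors_le_mul_rpow`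
(`DivisorBound`). Mathlib: `ArithmeticFunction.vonMangoldt_le_log`, `Real.log_le_rpow_div`,
`Real.log_le_sub_one_of_pos`, `Nat.lt_pow_succ_log_self`, `Nat.pow_log_le_self`, `Finset.sum_range_sub'`,
`Finset.sum_Ioc_consecutive`, `Nat.add_div`.
-/

noncomputable section

open Finset Real Complex
open ArithmeticFunction
open scoped ArithmeticFunction.Moebius ArithmeticFunction.zeta ArithmeticFunction.sigma
  ArithmeticFunction.vonMangoldt ArithmeticFunction.Omega

namespace Literature.NumberTheory.Sieve.FriedlanderIwaniecPrimes.PrimeSumEngine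

open Literature.NumberTheory.Sieve.Vaughan (cU gU fU arith_sub_apply sum_Ioc_sum_divisorsAntidiagonal_eq
  log_eq_sum_Ioc_sub log_sub_log_pred_nonneg abs_cU_le_log cU_eq_zero_of_lt vonMangoldt_eq_four_terms)
open Literature.NumberTheory.Sieve (moebiusTrunc vonMangoldtTrunc moebiusTrunc_apply vonMangoldtTrunc_apply)

/-! ### The hypotheses of the engine -/

/-- **Type-I hypothesis** (the shape of Proposition 23.2 after `τ(d)⁴ d^{1/2} log ≪ d`,
`N^{3/4} log N ≪ N^{4/5}`): `‖Σ_{n ≤ N} λ(dn)‖ ≤ W d N^{4/5}` for all `d, N ≥ 1`.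
[cite: FriedlanderIwaniecAnnals1998, Proposition 23.2 / §26] -/
def TypeIBound (lam : ℕ → ℂ) (W : ℝ) : Prop :=
  ∀ d N : ℕ, 1 ≤ d → 1 ≤ N → ‖∑ n ∈ Ioc 0 N, lam (d * n)‖ ≤ W * d * (N : ℝ) ^ (4 / 5 : ℝ)

/-- **Pointwise hypothesis**: `|λ(n)| ≤ B τ(n)`. [cite: FriedlanderIwaniecAnnals1998, §26] -/
def PointwiseBound (lam : ℕ → ℂ) (B : ℝ) : Prop :=
  ∀ n : ℕ, ‖lam n‖ ≤ B * (Nat.divisors n).card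

/-! ### Sums of a Dirichlet convolution against `λ` -/

/-- `Σ_{n ≤ x} (f * g)(n) λ(n) = Σ_{d ≤ x} f(d) Σ_{m ≤ x/d} g(m) λ(dm)` (Dirichlet's rearrangement).
[folklore] -/
theorem sum_mul_conv_eq (f g : ArithmeticFunction ℝ) (lam : ℕ → ℂ) (x : ℕ) :
    ∑ n ∈ Ioc 0 x, ((f * g) n : ℂ) * lam n =
      ∑ d ∈ Ioc 0 x, (f d : ℂ) * ∑ m ∈ Ioc 0 (x / d), (g m : ℂ) * lam (d * m) := by
  have h := sum_Ioc_sum_divisorsAntidiagonal_eq (fun d m => (f d : ℂ) * ((g m : ℂ) * lam (d * m))) x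
  calc ∑ n ∈ Ioc 0 x, ((f * g) n : ℂ) * lam n
      = ∑ n ∈ Ioc 0 x, ∑ p ∈ n.divisorsAntidiagonal, (f p.1 : ℂ) * ((g p.2 : ℂ) * lam (p.1 * p.2)) := by
        refine sum_congr rfl fun n _ => ?_
        rw [mul_apply, Complex.ofReal_sum, sum_mul]
        refine sum_congr rfl fun p hp => ?_
        rw [Nat.mem_divisorsAntidiagonal] at hp
        rw [hp.1]; push_cast; ring
    _ = ∑ d ∈ Ioc 0 x, ∑ m ∈ Ioc 0 (x / d), (f d : ℂ) * ((g m : ℂ) * lam (d * m)) := h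
    _ = ∑ d ∈ Ioc 0 x, (f d : ℂ) * ∑ m ∈ Ioc 0 (x / d), (g m : ℂ) * lam (d * m) := by
        refine sum_congr rfl fun d _ => ?_; rw [mul_sum]

/-! ### Abel summation with logarithmic weights -/

/-- **Abel summation**: if all partial sums `Σ_{m ≤ t} a_m`, `t ≤ X`, are bounded by `F`, then
`‖Σ_{m ≤ X} (log m) a_m‖ ≤ 2 F log X`. [folklore] -/
theorem norm_sum_log_mul_le (a : ℕ → ℂ) (X : ℕ) {F : ℝ}
    (hF : ∀ t, t ≤ X → ‖∑ m ∈ Ioc 0 t, a m‖ ≤ F) :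
    ‖∑ m ∈ Ioc 0 X, (Real.log m : ℂ) * a m‖ ≤ 2 * F * Real.log X := by
  have hF0 : 0 ≤ F := le_trans (norm_nonneg _) (hF 0 (Nat.zero_le X))
  -- the weights
  set w : ℕ → ℝ := fun j => Real.log j - Real.log (j - 1 : ℕ) with hw
  have hw0 : ∀ j, 0 ≤ w j := fun j => log_sub_log_pred_nonneg j
  -- `log m = Σ_{j ≤ X} [j ≤ m] w j` for `m ≤ X`
  have hlog : ∀ m ∈ Ioc 0 X, (Real.log m : ℂ) = ∑ j ∈ Ioc 0 X, if j ≤ m then (w j : ℂ) else 0 := by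
    intro m hm
    rw [mem_Ioc] at hm
    rw [log_eq_sum_Ioc_sub m, Complex.ofReal_sum, ← sum_filter]
    refine sum_congr ?_ fun j _ => rfl
    ext j; simp only [mem_Ioc, mem_filter]; omega
  have hswap : ∑ m ∈ Ioc 0 X, (Real.log m : ℂ) * a m =
      ∑ j ∈ Ioc 0 X, (w j : ℂ) * (∑ m ∈ Ioc 0 X, a m - ∑ m ∈ Ioc 0 (j - 1), a m) := by
    rw [sum_congr rfl fun m hm => by rw [hlog m hm, sum_mul], sum_comm]
    refine sum_congr rfl fun j hj => ?_
    rw [mem_Ioc] at hj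
    have hsplit := sum_Ioc_consecutive a (Nat.zero_le (j - 1)) (by omega : j - 1 ≤ X)
    rw [← hsplit, add_sub_cancel_left, mul_sum]
    simp_rw [ite_mul, zero_mul]
    rw [← sum_filter]
    refine sum_congr ?_ fun m _ => rfl
    ext m; simp only [mem_filter, mem_Ioc]; omega
  rw [hswap]
  calc ‖∑ j ∈ Ioc 0 X, (w j : ℂ) * (∑ m ∈ Ioc 0 X, a m - ∑ m ∈ Ioc 0 (j - 1), a m)‖
      ≤ ∑ j ∈ Ioc 0 X, w j * (2 * F) := by
        refine (norm_sum_le _ _).trans (sum_le_sum fun j hj => ?_)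
        rw [mem_Ioc] at hj
        rw [norm_mul, Complex.norm_real, Real.norm_of_nonneg (hw0 j)]
        refine mul_le_mul_of_nonneg_left ?_ (hw0 j)
        calc ‖∑ m ∈ Ioc 0 X, a m - ∑ m ∈ Ioc 0 (j - 1), a m‖
            ≤ ‖∑ m ∈ Ioc 0 X, a m‖ + ‖∑ m ∈ Ioc 0 (j - 1), a m‖ := norm_sub_le _ _
          _ ≤ F + F := add_le_add (hF X le_rfl) (hF (j - 1) (by omega))
          _ = 2 * F := by ring
    _ = 2 * F * Real.log X := by
        rw [← sum_mul, show ∑ j ∈ Ioc 0 X, w j = Real.log X from (log_eq_sum_Ioc_sub X).symm]; ring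

/-! ### The type-I pieces -/

section

variable {lam : ℕ → ℂ} {W B : ℝ}

/-- Partial sums on `t ≤ X` from the type-I hypothesis: `‖Σ_{m ≤ t} λ(dm)‖ ≤ W d X^{4/5}`.
[cite: FriedlanderIwaniecAnnals1998, §26] -/
theorem norm_partial_le (hI : TypeIBound lam W) (hW : 0 ≤ W) {d : ℕ} (hd : 1 ≤ d) (X t : ℕ) (ht : t ≤ X) :
    ‖∑ m ∈ Ioc 0 t, lam (d * m)‖ ≤ W * d * (X : ℝ) ^ (4 / 5 : ℝ) := by
  rcases Nat.eq_zero_or_pos t with rfl | ht0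
  · simp only [Ioc_self, sum_empty, norm_zero]; positivity
  · refine (hI d t hd ht0).trans ?_
    gcongr

/-- `Σ_{d ≤ U} d (x/d)^{4/5} ≤ x^{4/5} U^{6/5}` (crudely: each term is `≤ x^{4/5} U^{1/5}`). [folklore] -/
theorem sum_mul_div_rpow_le (x U : ℕ) :
    ∑ d ∈ Ioc 0 U, (d : ℝ) * ((x / d : ℕ) : ℝ) ^ (4 / 5 : ℝ) ≤ (x : ℝ) ^ (4 / 5 : ℝ) * (U : ℝ) ^ (6 / 5 : ℝ) := by
  have hterm : ∀ d ∈ Ioc 0 U, (d : ℝ) * ((x / d : ℕ) : ℝ) ^ (4 / 5 : ℝ) ≤ (x : ℝ) ^ (4 / 5 : ℝ) * (U : ℝ) ^ (1 / 5 : ℝ) := by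
    intro d hd
    rw [mem_Ioc] at hd
    have hd0 : (0 : ℝ) < d := by exact_mod_cast hd.1
    have h1 : ((x / d : ℕ) : ℝ) ≤ (x : ℝ) / d := Nat.cast_div_le
    calc (d : ℝ) * ((x / d : ℕ) : ℝ) ^ (4 / 5 : ℝ) ≤ (d : ℝ) * ((x : ℝ) / d) ^ (4 / 5 : ℝ) := by
          gcongr
      _ = (x : ℝ) ^ (4 / 5 : ℝ) * (d : ℝ) ^ (1 / 5 : ℝ) := by
          rw [Real.div_rpow (Nat.cast_nonneg x) hd0.le]
          have h45 : (0 : ℝ) < (d : ℝ) ^ (4 / 5 : ℝ) := Real.rpow_pos_of_pos hd0 _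
          have hsplit : (d : ℝ) = (d : ℝ) ^ (1 / 5 : ℝ) * (d : ℝ) ^ (4 / 5 : ℝ) := by
            rw [← Real.rpow_add hd0]; norm_num
          have hdiv : (d : ℝ) / (d : ℝ) ^ (4 / 5 : ℝ) = (d : ℝ) ^ (1 / 5 : ℝ) := by
            rw [div_eq_iff h45.ne', ← hsplit]
          calc (d : ℝ) * ((x : ℝ) ^ (4 / 5 : ℝ) / (d : ℝ) ^ (4 / 5 : ℝ))
              = (x : ℝ) ^ (4 / 5 : ℝ) * ((d : ℝ) / (d : ℝ) ^ (4 / 5 : ℝ)) := by ring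
            _ = (x : ℝ) ^ (4 / 5 : ℝ) * (d : ℝ) ^ (1 / 5 : ℝ) := by rw [hdiv]
      _ ≤ (x : ℝ) ^ (4 / 5 : ℝ) * (U : ℝ) ^ (1 / 5 : ℝ) := by
          gcongr; exact_mod_cast hd.2
  refine (sum_le_sum hterm).trans ?_
  rw [sum_const, Nat.card_Ioc, Nat.sub_zero, nsmul_eq_mul]
  rcases Nat.eq_zero_or_pos U with rfl | hU
  · simp
  · have hU0 : (0 : ℝ) < U := by exact_mod_cast hU
    have h65 : (U : ℝ) ^ (6 / 5 : ℝ) = U * (U : ℝ) ^ (1 / 5 : ℝ) := by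
      rw [show (6 / 5 : ℝ) = 1 + 1 / 5 by norm_num, Real.rpow_add hU0, Real.rpow_one]
    rw [h65]
    exact le_of_eq (by ring)

/-- **Type-I piece with the logarithm** (the term `μ_{≤U} * log` of Vaughan's identity):
`‖Σ_{n ≤ x} (μ_{≤U} * log)(n) λ(n)‖ ≤ 2 W x^{4/5} U^{6/5} log x`.
[cite: FriedlanderIwaniecAnnals1998, §26 (26.3) and Proposition 23.2] -/
theorem norm_sum_moebiusTrunc_log_le (hI : TypeIBound lam W) (hW : 0 ≤ W) (x U : ℕ) :
    ‖∑ n ∈ Ioc 0 x, ((((moebiusTrunc U : ArithmeticFunction ℤ) : ArithmeticFunction ℝ) *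
        ArithmeticFunction.log) n : ℂ) * lam n‖ ≤
      2 * W * (x : ℝ) ^ (4 / 5 : ℝ) * (U : ℝ) ^ (6 / 5 : ℝ) * Real.log x := by
  rw [sum_mul_conv_eq]
  have hlogx : 0 ≤ Real.log x := Real.log_natCast_nonneg x
  -- only `d ≤ U` contribute
  have hvan : ∀ d ∈ Ioc 0 x, U < d → ((((moebiusTrunc U : ArithmeticFunction ℤ) : ArithmeticFunction ℝ) d : ℝ) : ℂ) *
      ∑ m ∈ Ioc 0 (x / d), ((ArithmeticFunction.log m : ℝ) : ℂ) * lam (d * m) = 0 := by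
    intro d _ hd
    rw [intCoe_apply, moebiusTrunc_apply, if_neg (not_le.mpr hd)]; simp
  have hsplit : ∑ d ∈ Ioc 0 x, ((((moebiusTrunc U : ArithmeticFunction ℤ) : ArithmeticFunction ℝ) d : ℝ) : ℂ) *
      ∑ m ∈ Ioc 0 (x / d), ((ArithmeticFunction.log m : ℝ) : ℂ) * lam (d * m) =
      ∑ d ∈ (Ioc 0 x).filter (· ≤ U), ((((moebiusTrunc U : ArithmeticFunction ℤ) : ArithmeticFunction ℝ) d : ℝ) : ℂ) *
        ∑ m ∈ Ioc 0 (x / d), ((ArithmeticFunction.log m : ℝ) : ℂ) * lam (d * m) := by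
    rw [sum_filter]
    refine sum_congr rfl fun d hd => ?_
    split_ifs with h
    · rfl
    · exact hvan d hd (not_le.mp h)
  rw [hsplit]
  have hsub : (Ioc 0 x).filter (· ≤ U) ⊆ Ioc 0 U := by
    intro d hd; rw [mem_filter, mem_Ioc] at hd; rw [mem_Ioc]; exact ⟨hd.1.1, hd.2⟩
  calc ‖∑ d ∈ (Ioc 0 x).filter (· ≤ U), ((((moebiusTrunc U : ArithmeticFunction ℤ) : ArithmeticFunction ℝ) d : ℝ) : ℂ) *
        ∑ m ∈ Ioc 0 (x / d), ((ArithmeticFunction.log m : ℝ) : ℂ) * lam (d * m)‖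
      ≤ ∑ d ∈ (Ioc 0 x).filter (· ≤ U), 1 * (2 * (W * d * ((x / d : ℕ) : ℝ) ^ (4 / 5 : ℝ)) * Real.log x) := by
        refine (norm_sum_le _ _).trans (sum_le_sum fun d hd => ?_)
        rw [mem_filter, mem_Ioc] at hd
        have hd1 : 1 ≤ d := hd.1.1
        have hxd : 0 < x / d := Nat.div_pos hd.1.2 hd1
        rw [norm_mul]
        refine mul_le_mul ?_ ?_ (norm_nonneg _) zero_le_one
        · rw [intCoe_apply, moebiusTrunc_apply, if_pos hd.2, Complex.norm_real, Real.norm_eq_abs,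
            ← Int.cast_abs]
          exact_mod_cast abs_moebius_le_one
        · have h := norm_sum_log_mul_le (fun m => lam (d * m)) (x / d)
            (F := W * d * ((x / d : ℕ) : ℝ) ^ (4 / 5 : ℝ)) fun t ht => norm_partial_le hI hW hd1 (x / d) t ht
          simp only [ArithmeticFunction.log_apply] at h ⊢
          refine h.trans ?_
          have hlog : Real.log ((x / d : ℕ) : ℝ) ≤ Real.log x :=
            Real.log_le_log (by exact_mod_cast hxd) (by exact_mod_cast Nat.div_le_self x d)
          have h0 : 0 ≤ 2 * (W * d * ((x / d : ℕ) : ℝ) ^ (4 / 5 : ℝ)) := by positivity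
          exact mul_le_mul_of_nonneg_left hlog h0
    _ = 2 * W * Real.log x * ∑ d ∈ (Ioc 0 x).filter (· ≤ U), (d : ℝ) * ((x / d : ℕ) : ℝ) ^ (4 / 5 : ℝ) := by
        rw [mul_sum]; refine sum_congr rfl fun d _ => ?_; ring
    _ ≤ 2 * W * Real.log x * ∑ d ∈ Ioc 0 U, (d : ℝ) * ((x / d : ℕ) : ℝ) ^ (4 / 5 : ℝ) := by
        refine mul_le_mul_of_nonneg_left ?_ (by positivity)
        exact sum_le_sum_of_subset_of_nonneg hsub fun d _ _ => by positivity
    _ ≤ 2 * W * Real.log x * ((x : ℝ) ^ (4 / 5 : ℝ) * (U : ℝ) ^ (6 / 5 : ℝ)) :=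
        mul_le_mul_of_nonneg_left (sum_mul_div_rpow_le x U) (by positivity)
    _ = 2 * W * (x : ℝ) ^ (4 / 5 : ℝ) * (U : ℝ) ^ (6 / 5 : ℝ) * Real.log x := by ring

/-- **Type-I piece without logarithm** (the term `c_U * 1` of Vaughan's identity, `c_U(d) = 0` for
`d > U²`, `|c_U| ≤ log`): `‖Σ_{n ≤ x} (c_U * ζ)(n) λ(n)‖ ≤ 2 W x^{4/5} U^{12/5} log U`.
[cite: FriedlanderIwaniecAnnals1998, §26 (26.3) and Proposition 23.2] -/
theorem norm_sum_cU_zeta_le (hI : TypeIBound lam W) (hW : 0 ≤ W) (x U : ℕ) :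
    ‖∑ n ∈ Ioc 0 x, ((cU U * (ζ : ArithmeticFunction ℝ)) n : ℂ) * lam n‖ ≤
      2 * W * (x : ℝ) ^ (4 / 5 : ℝ) * ((U * U : ℕ) : ℝ) ^ (6 / 5 : ℝ) * Real.log U := by
  rw [sum_mul_conv_eq]
  -- the inner sums are `Σ_{m ≤ x/d} λ(dm)`
  have hinner : ∀ d ∈ Ioc 0 x, ∑ m ∈ Ioc 0 (x / d), (((ζ : ArithmeticFunction ℝ) m : ℝ) : ℂ) * lam (d * m) =
      ∑ m ∈ Ioc 0 (x / d), lam (d * m) := by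
    intro d _
    refine sum_congr rfl fun m hm => ?_
    rw [mem_Ioc] at hm
    rw [natCoe_apply, zeta_apply, if_neg (by omega)]; simp
  rw [sum_congr rfl fun d hd => by rw [hinner d hd]]
  -- only `d ≤ U²` contribute
  have hsplit : ∑ d ∈ Ioc 0 x, ((cU U d : ℝ) : ℂ) * ∑ m ∈ Ioc 0 (x / d), lam (d * m) =
      ∑ d ∈ (Ioc 0 x).filter (· ≤ U * U), ((cU U d : ℝ) : ℂ) * ∑ m ∈ Ioc 0 (x / d), lam (d * m) := by
    rw [sum_filter]
    refine sum_congr rfl fun d _ => ?_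
    split_ifs with h
    · rfl
    · rw [cU_eq_zero_of_lt (not_le.mp h)]; simp
  rw [hsplit]
  have hsub : (Ioc 0 x).filter (· ≤ U * U) ⊆ Ioc 0 (U * U) := by
    intro d hd; rw [mem_filter, mem_Ioc] at hd; rw [mem_Ioc]; exact ⟨hd.1.1, hd.2⟩
  have hlogU : 0 ≤ Real.log U := Real.log_natCast_nonneg U
  calc ‖∑ d ∈ (Ioc 0 x).filter (· ≤ U * U), ((cU U d : ℝ) : ℂ) * ∑ m ∈ Ioc 0 (x / d), lam (d * m)‖
      ≤ ∑ d ∈ (Ioc 0 x).filter (· ≤ U * U), (2 * Real.log U) * (W * d * ((x / d : ℕ) : ℝ) ^ (4 / 5 : ℝ)) := by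
        refine (norm_sum_le _ _).trans (sum_le_sum fun d hd => ?_)
        rw [mem_filter, mem_Ioc] at hd
        have hd1 : 1 ≤ d := hd.1.1
        have hxd : 0 < x / d := Nat.div_pos hd.1.2 hd1
        rw [norm_mul]
        refine mul_le_mul ?_ (hI d (x / d) hd1 hxd) (norm_nonneg _) (by positivity)
        rw [Complex.norm_real, Real.norm_eq_abs]
        refine (abs_cU_le_log U d).trans ?_
        have hd0 : (0 : ℝ) < d := by exact_mod_cast hd1
        calc Real.log d ≤ Real.log ((U * U : ℕ) : ℝ) := Real.log_le_log hd0 (by exact_mod_cast hd.2)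
          _ = 2 * Real.log U := by push_cast; rw [Real.log_mul] <;> [ring; skip; skip] <;>
              exact Nat.cast_ne_zero.mpr (by rintro rfl; simp at hd; omega)
    _ = 2 * W * Real.log U * ∑ d ∈ (Ioc 0 x).filter (· ≤ U * U), (d : ℝ) * ((x / d : ℕ) : ℝ) ^ (4 / 5 : ℝ) := by
        rw [mul_sum]; refine sum_congr rfl fun d _ => ?_; ring
    _ ≤ 2 * W * Real.log U * ∑ d ∈ Ioc 0 (U * U), (d : ℝ) * ((x / d : ℕ) : ℝ) ^ (4 / 5 : ℝ) := by
        refine mul_le_mul_of_nonneg_left ?_ (by positivity)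
        exact sum_le_sum_of_subset_of_nonneg hsub fun d _ _ => by positivity
    _ ≤ 2 * W * Real.log U * ((x : ℝ) ^ (4 / 5 : ℝ) * ((U * U : ℕ) : ℝ) ^ (6 / 5 : ℝ)) :=
        mul_le_mul_of_nonneg_left (sum_mul_div_rpow_le x (U * U)) (by positivity)
    _ = 2 * W * (x : ℝ) ^ (4 / 5 : ℝ) * ((U * U : ℕ) : ℝ) ^ (6 / 5 : ℝ) * Real.log U := by ring

/-- **The short piece** (the term `Λ_{≤U}` of Vaughan's identity), crudely:
`‖Σ_{n ≤ x} Λ_{≤U}(n) λ(n)‖ ≤ B U³` (from `Λ(n) ≤ log n ≤ n`, `τ(n) ≤ n`).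
[cite: FriedlanderIwaniecAnnals1998, §26 (26.3)] -/
theorem norm_sum_vonMangoldtTrunc_le (hB : PointwiseBound lam B) (hB0 : 0 ≤ B) (x U : ℕ) :
    ‖∑ n ∈ Ioc 0 x, ((vonMangoldtTrunc U n : ℝ) : ℂ) * lam n‖ ≤ B * (U : ℝ) ^ 3 := by
  have hsplit : ∑ n ∈ Ioc 0 x, ((vonMangoldtTrunc U n : ℝ) : ℂ) * lam n =
      ∑ n ∈ (Ioc 0 x).filter (· ≤ U), ((vonMangoldtTrunc U n : ℝ) : ℂ) * lam n := by
    rw [sum_filter]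
    refine sum_congr rfl fun n _ => ?_
    split_ifs with h
    · rfl
    · rw [vonMangoldtTrunc_apply, if_neg h]; simp
  rw [hsplit]
  have hsub : (Ioc 0 x).filter (· ≤ U) ⊆ Ioc 0 U := by
    intro d hd; rw [mem_filter, mem_Ioc] at hd; rw [mem_Ioc]; exact ⟨hd.1.1, hd.2⟩
  calc ‖∑ n ∈ (Ioc 0 x).filter (· ≤ U), ((vonMangoldtTrunc U n : ℝ) : ℂ) * lam n‖
      ≤ ∑ n ∈ (Ioc 0 x).filter (· ≤ U), (U : ℝ) * (B * U) := by
        refine (norm_sum_le _ _).trans (sum_le_sum fun n hn => ?_)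
        rw [mem_filter, mem_Ioc] at hn
        have hn0 : (0 : ℝ) < n := by exact_mod_cast hn.1.1
        have hnU : (n : ℝ) ≤ U := by exact_mod_cast hn.2
        rw [norm_mul, Complex.norm_real, Real.norm_eq_abs, vonMangoldtTrunc_apply, if_pos hn.2,
          abs_of_nonneg vonMangoldt_nonneg]
        refine mul_le_mul ?_ ?_ (norm_nonneg _) (Nat.cast_nonneg U)
        · calc ArithmeticFunction.vonMangoldt n ≤ Real.log n := vonMangoldt_le_log
            _ ≤ n - 1 := Real.log_le_sub_one_of_pos hn0
            _ ≤ U := by linarith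
        · calc ‖lam n‖ ≤ B * (Nat.divisors n).card := hB n
            _ ≤ B * n := by gcongr; exact_mod_cast Nat.card_divisors_le_self n
            _ ≤ B * U := by gcongr
    _ ≤ ∑ n ∈ Ioc 0 U, (U : ℝ) * (B * U) :=
        sum_le_sum_of_subset_of_nonneg hsub fun n _ _ => by positivity
    _ = B * (U : ℝ) ^ 3 := by
        rw [sum_const, Nat.card_Ioc, Nat.sub_zero, nsmul_eq_mul]; ring

end

/-! ### The type-II hypothesis -/

/-- The fixed small exponent `η = 10⁻⁴` at which the type-II hypothesis is used.
[cite: FriedlanderIwaniecAnnals1998, §26] -/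
def eta : ℝ := 1 / 10000

/-- **Type-II hypothesis** (the shape of Proposition 23.1 for `L(M, N)` at `ε = η`): for all
`M, N ≥ 1` and all coefficients bounded by `1`,
`‖Σ_{m ≤ M} Σ_{n ≤ N} α(m) β(n) λ(mn)‖ ≤ W (M + N)^{1/12} (MN)^{11/12 + η}`.
[cite: FriedlanderIwaniecAnnals1998, Proposition 23.1 / §26] -/
def TypeIIBound (lam : ℕ → ℂ) (W : ℝ) : Prop :=
  ∀ M N : ℕ, 1 ≤ M → 1 ≤ N → ∀ α β : ℕ → ℂ, (∀ m, ‖α m‖ ≤ 1) → (∀ n, ‖β n‖ ≤ 1) →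
    ‖∑ m ∈ Ioc 0 M, ∑ n ∈ Ioc 0 N, α m * β n * lam (m * n)‖ ≤
      W * ((M : ℝ) + N) ^ (1 / 12 : ℝ) * ((M : ℝ) * N) ^ (11 / 12 + eta)

section

variable {lam : ℕ → ℂ} {W : ℝ}

/-- **Scaling**: coefficients bounded by `A` and `B'` give `A B'` times the type-II bound.
[cite: FriedlanderIwaniecAnnals1998, §26] -/
theorem norm_bilinear_le (hII : TypeIIBound lam W) {M N : ℕ} (hM : 1 ≤ M) (hN : 1 ≤ N)
    {A B' : ℝ} (hA : 0 ≤ A) (hB' : 0 ≤ B') (α β : ℕ → ℂ) (hα : ∀ m, ‖α m‖ ≤ A) (hβ : ∀ n, ‖β n‖ ≤ B') :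
    ‖∑ m ∈ Ioc 0 M, ∑ n ∈ Ioc 0 N, α m * β n * lam (m * n)‖ ≤
      A * B' * (W * ((M : ℝ) + N) ^ (1 / 12 : ℝ) * ((M : ℝ) * N) ^ (11 / 12 + eta)) := by
  rcases hA.lt_or_eq with hA0 | hA0
  swap
  · -- `A = 0`: all `α` vanish
    have hα0 : ∀ m, α m = 0 := fun m => norm_le_zero_iff.mp (hA0 ▸ hα m)
    rw [← hA0]; simp [hα0]
  rcases hB'.lt_or_eq with hB0 | hB0
  swap
  · have hβ0 : ∀ n, β n = 0 := fun n => norm_le_zero_iff.mp (hB0 ▸ hβ n)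
    rw [← hB0]; simp [hβ0]
  have h := hII M N hM hN (fun m => α m / A) (fun n => β n / B')
    (fun m => by rw [norm_div, Complex.norm_real, Real.norm_of_nonneg hA, div_le_one hA0]; exact hα m)
    (fun n => by rw [norm_div, Complex.norm_real, Real.norm_of_nonneg hB', div_le_one hB0]; exact hβ n)
  have hscale : ∑ m ∈ Ioc 0 M, ∑ n ∈ Ioc 0 N, α m / A * (β n / B') * lam (m * n) =
      (∑ m ∈ Ioc 0 M, ∑ n ∈ Ioc 0 N, α m * β n * lam (m * n)) / (A * B') := by
    rw [sum_div]; refine sum_congr rfl fun m _ => ?_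
    rw [sum_div]; refine sum_congr rfl fun n _ => ?_
    field_simp
  rw [hscale, norm_div, div_le_iff₀ (by rw [norm_mul, Complex.norm_real, Complex.norm_real,
    Real.norm_of_nonneg hA, Real.norm_of_nonneg hB']; positivity)] at h
  rw [norm_mul, Complex.norm_real, Complex.norm_real, Real.norm_of_nonneg hA, Real.norm_of_nonneg hB'] at h
  linarith

/-! ### One short interval of `d`: rectangle plus boundary -/

/-- **Separation on a short interval** `d ∈ (D₁, D₂]`: with `N₂ = ⌊x/D₂⌋`,
`Σ_{D₁ < d ≤ D₂} a(d) Σ_{m ≤ x/d} b(m) λ(dm)` is the bilinear form on the rectangle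
`(D₁, D₂] × [1, N₂]` plus the boundary terms `N₂ < m ≤ x/d`, whence
`‖…‖ ≤ A B' W (D₂ + N₂)^{1/12} (D₂ N₂)^{11/12+η} + A B' L (D₂ - D₁)(⌊x/D₁⌋ - N₂)` for `|a| ≤ A`,
`|b| ≤ B'` and `|λ(n)| ≤ L` (`n ≤ x`). [cite: FriedlanderIwaniecAnnals1998, §26 ("splitting into
short interval summation so that the separation of variables is not compromised too much")] -/
theorem norm_shortInterval_le (hII : TypeIIBound lam W) {x D₁ D₂ : ℕ} (hD₁ : 0 < D₁) (hD : D₁ ≤ D₂)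
    (hD₂x : D₂ ≤ x) {A B' L : ℝ} (hA : 0 ≤ A) (hB' : 0 ≤ B') (hL : 0 ≤ L)
    (a b : ℕ → ℂ) (ha : ∀ d, d ≤ x → ‖a d‖ ≤ A) (hb : ∀ m, m ≤ x → ‖b m‖ ≤ B')
    (hlam : ∀ n, n ≤ x → ‖lam n‖ ≤ L) :
    ‖∑ d ∈ Ioc D₁ D₂, a d * ∑ m ∈ Ioc 0 (x / d), b m * lam (d * m)‖ ≤
      A * B' * (W * ((D₂ : ℝ) + (x / D₂ : ℕ)) ^ (1 / 12 : ℝ) * ((D₂ : ℝ) * (x / D₂ : ℕ)) ^ (11 / 12 + eta)) +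
        A * B' * L * ((D₂ - D₁ : ℕ) : ℝ) * ((x / D₁ - x / D₂ : ℕ) : ℝ) := by
  set N₂ := x / D₂ with hN₂
  have hD₂ : 0 < D₂ := lt_of_lt_of_le hD₁ hD
  -- split the inner sums at `N₂`
  have hinner : ∀ d ∈ Ioc D₁ D₂, ∑ m ∈ Ioc 0 (x / d), b m * lam (d * m) =
      ∑ m ∈ Ioc 0 N₂, b m * lam (d * m) + ∑ m ∈ Ioc N₂ (x / d), b m * lam (d * m) := by
    intro d hd
    rw [mem_Ioc] at hd
    exact (sum_Ioc_consecutive _ (Nat.zero_le N₂) (Nat.div_le_div_left hd.2 (by omega))).symm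
  rw [sum_congr rfl fun d hd => by rw [hinner d hd, mul_add], sum_add_distrib]
  refine (norm_add_le _ _).trans (add_le_add ?_ ?_)
  · -- the rectangle: a bilinear form on `[1, D₂] × [1, N₂]` with `α = a 1_{(D₁, D₂]}`
    have hN₂1 : 1 ≤ N₂ := (Nat.div_pos hD₂x hD₂)
    have hN₂x : N₂ ≤ x := Nat.div_le_self x D₂
    have hrect : ∑ d ∈ Ioc D₁ D₂, a d * ∑ m ∈ Ioc 0 N₂, b m * lam (d * m) =
        ∑ d ∈ Ioc 0 D₂, ∑ m ∈ Ioc 0 N₂, (if D₁ < d ∧ d ≤ D₂ then a d else 0) *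
          (if m ≤ N₂ then b m else 0) * lam (d * m) := by
      have hsub : Ioc D₁ D₂ = (Ioc 0 D₂).filter fun d => D₁ < d ∧ d ≤ D₂ := by
        ext d; simp only [mem_Ioc, mem_filter]; omega
      rw [hsub, sum_filter]
      refine sum_congr rfl fun d _ => ?_
      split_ifs with h
      · rw [mul_sum]; refine sum_congr rfl fun m hm => ?_
        rw [mem_Ioc] at hm; rw [if_pos hm.2]; ring
      · simp
    rw [hrect]
    refine norm_bilinear_le hII hD₂ hN₂1 hA hB' _ _ (fun d => ?_) (fun m => ?_)
    · split_ifs with h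
      · exact ha d (h.2.trans hD₂x)
      · rw [norm_zero]; exact hA
    · split_ifs with h
      · exact hb m (h.trans hN₂x)
      · rw [norm_zero]; exact hB'
  · -- the boundary terms
    calc ‖∑ d ∈ Ioc D₁ D₂, a d * ∑ m ∈ Ioc N₂ (x / d), b m * lam (d * m)‖
        ≤ ∑ d ∈ Ioc D₁ D₂, A * ∑ m ∈ Ioc N₂ (x / d), B' * L := by
          refine (norm_sum_le _ _).trans (sum_le_sum fun d hd => ?_)
          rw [mem_Ioc] at hd
          rw [norm_mul]
          refine mul_le_mul (ha d (hd.2.trans hD₂x)) ((norm_sum_le _ _).trans (sum_le_sum fun m hm => ?_))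
            (norm_nonneg _) hA
          rw [mem_Ioc] at hm
          rw [norm_mul]
          have hdm : d * m ≤ x := (Nat.mul_le_mul_left d hm.2).trans (Nat.mul_div_le x d)
          refine mul_le_mul (hb m ?_) (hlam _ hdm) (norm_nonneg _) hB'
          exact le_trans (Nat.le_mul_of_pos_left m (by omega)) hdm
      _ ≤ ∑ d ∈ Ioc D₁ D₂, A * (((x / D₁ - x / D₂ : ℕ) : ℝ) * (B' * L)) := by
          refine sum_le_sum fun d hd => mul_le_mul_of_nonneg_left ?_ hA
          rw [mem_Ioc] at hd
          rw [sum_const, nsmul_eq_mul, Nat.card_Ioc]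
          have h1 : x / d ≤ x / D₁ := Nat.div_le_div_left (by omega) hD₁
          have h2 : ((x / d - N₂ : ℕ) : ℝ) ≤ ((x / D₁ - x / D₂ : ℕ) : ℝ) := by
            exact_mod_cast (by omega : x / d - N₂ ≤ x / D₁ - x / D₂)
          exact mul_le_mul_of_nonneg_right h2 (mul_nonneg hB' hL)
      _ = A * B' * L * ((D₂ - D₁ : ℕ) : ℝ) * ((x / D₁ - x / D₂ : ℕ) : ℝ) := by
          rw [sum_const, nsmul_eq_mul, Nat.card_Ioc]; ring

/-! ### One dyadic block `d ∈ (D, 2D]`, cut into `K` short intervals -/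

/-- Decomposition of `(E 0, E n]` along a monotone sequence of cut points. [folklore] -/
theorem sum_Ioc_eq_sum_range_pieces {M : Type*} [AddCommMonoid M] (F : ℕ → M) {E : ℕ → ℕ}
    (hE : Monotone E) (n : ℕ) :
    ∑ d ∈ Ioc (E 0) (E n), F d = ∑ i ∈ range n, ∑ d ∈ Ioc (E i) (E (i + 1)), F d := by
  induction n with
  | zero => simp
  | succ n ih =>
    rw [sum_range_succ, ← ih]
    exact (sum_Ioc_consecutive F (hE (Nat.zero_le n)) (hE (Nat.le_succ n))).symm

/-- **The block estimate**: for `0 < D`, `2D ≤ x`, `1 ≤ K`, coefficients `|a| ≤ A`, `|b| ≤ B'` on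
`[1, x]` and `|λ| ≤ L` on `[1, x]`,
`‖Σ_{D < d ≤ 2D} a(d) Σ_{m ≤ x/d} b(m) λ(dm)‖ ≤ K · A B' W (2D + x/D)^{1/12} x^{11/12+η} + A B' L (D/K + 1)(x/D)`
(the `K` rectangles by the type-II hypothesis, the boundary strips by the trivial bound; the strip
widths telescope). [cite: FriedlanderIwaniecAnnals1998, §26] -/
theorem norm_block_le (hII : TypeIIBound lam W) (hW : 0 ≤ W) {x D K : ℕ} (hD : 0 < D) (h2D : 2 * D ≤ x)
    (hK : 0 < K) {A B' L : ℝ} (hA : 0 ≤ A) (hB' : 0 ≤ B') (hL : 0 ≤ L)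
    (a b : ℕ → ℂ) (ha : ∀ d, d ≤ x → ‖a d‖ ≤ A) (hb : ∀ m, m ≤ x → ‖b m‖ ≤ B')
    (hlam : ∀ n, n ≤ x → ‖lam n‖ ≤ L) :
    ‖∑ d ∈ Ioc D (2 * D), a d * ∑ m ∈ Ioc 0 (x / d), b m * lam (d * m)‖ ≤
      K * (A * B' * (W * ((2 * D : ℕ) + (x / D : ℕ) : ℝ) ^ (1 / 12 : ℝ) * (x : ℝ) ^ (11 / 12 + eta))) +
        A * B' * L * (((D / K + 1 : ℕ) : ℝ) * ((x / D : ℕ) : ℝ)) := by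
  -- the cut points
  set E : ℕ → ℕ := fun i => D + i * D / K with hE
  have hEmono : Monotone E := fun i j hij => by
    simp only [hE]; exact Nat.add_le_add_left (Nat.div_le_div_right (Nat.mul_le_mul_right D hij)) D
  have hE0 : E 0 = D := by simp [hE]
  have hEK : E K = 2 * D := by simp only [hE]; rw [Nat.mul_div_cancel_left D hK]; ring
  have hEge : ∀ i, D ≤ E i := fun i => Nat.le_add_right D _
  have hEle : ∀ i, i ≤ K → E i ≤ 2 * D := fun i hi => by rw [← hEK]; exact hEmono hi
  have hstep : ∀ i, E (i + 1) - E i ≤ D / K + 1 := by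
    intro i
    simp only [hE]
    have : (i * D + D) / K ≤ i * D / K + D / K + 1 := by
      rw [Nat.add_div hK]; split_ifs <;> omega
    rw [show (i + 1) * D = i * D + D by ring]
    generalize (i * D + D) / K = p at this ⊢
    generalize i * D / K = q at this ⊢
    generalize D / K = s at this ⊢
    omega
  have hsum : ∑ d ∈ Ioc D (2 * D), a d * ∑ m ∈ Ioc 0 (x / d), b m * lam (d * m) =
      ∑ i ∈ range K, ∑ d ∈ Ioc (E i) (E (i + 1)), a d * ∑ m ∈ Ioc 0 (x / d), b m * lam (d * m) := by
    rw [← sum_Ioc_eq_sum_range_pieces _ hEmono K, hE0, hEK]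
  rw [hsum]
  -- the common main term and the telescoping boundary terms
  set Main : ℝ := A * B' * (W * ((2 * D : ℕ) + (x / D : ℕ) : ℝ) ^ (1 / 12 : ℝ) * (x : ℝ) ^ (11 / 12 + eta))
    with hMain
  have hpiece : ∀ i ∈ range K, ‖∑ d ∈ Ioc (E i) (E (i + 1)), a d * ∑ m ∈ Ioc 0 (x / d), b m * lam (d * m)‖ ≤
      Main + A * B' * L * ((D / K + 1 : ℕ) : ℝ) * (((x / E i : ℕ) : ℝ) - ((x / E (i + 1) : ℕ) : ℝ)) := by
    intro i hi
    rw [mem_range] at hi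
    have hD₁ : 0 < E i := lt_of_lt_of_le hD (hEge i)
    have hD₂x : E (i + 1) ≤ x := (hEle (i + 1) hi).trans h2D
    refine (norm_shortInterval_le hII hD₁ (hEmono (Nat.le_succ i)) hD₂x hA hB' hL a b ha hb hlam).trans
      (add_le_add ?_ ?_)
    · -- main term monotonicity
      rw [hMain]
      refine mul_le_mul_of_nonneg_left ?_ (mul_nonneg hA hB')
      have h1 : ((E (i + 1) : ℕ) : ℝ) + ((x / E (i + 1) : ℕ) : ℝ) ≤ ((2 * D : ℕ) : ℝ) + ((x / D : ℕ) : ℝ) := by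
        have hle1 : E (i + 1) ≤ 2 * D := hEle (i + 1) hi
        have hle2 : x / E (i + 1) ≤ x / D := Nat.div_le_div_left (hEge (i + 1)) hD
        exact_mod_cast add_le_add hle1 hle2
      have h2 : ((E (i + 1) : ℕ) : ℝ) * ((x / E (i + 1) : ℕ) : ℝ) ≤ (x : ℝ) := by
        exact_mod_cast Nat.mul_div_le x (E (i + 1))
      have hη : (0 : ℝ) < 11 / 12 + eta := by rw [eta]; norm_num
      gcongr
    · -- boundary term
      have hsub : ((E (i + 1) - E i : ℕ) : ℝ) ≤ ((D / K + 1 : ℕ) : ℝ) := by exact_mod_cast hstep i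
      have hmono : x / E (i + 1) ≤ x / E i := Nat.div_le_div_left (hEmono (Nat.le_succ i)) hD₁
      have hdiff : ((x / E i - x / E (i + 1) : ℕ) : ℝ) = ((x / E i : ℕ) : ℝ) - ((x / E (i + 1) : ℕ) : ℝ) := by
        rw [Nat.cast_sub hmono]
      rw [hdiff]
      have hnn : (0 : ℝ) ≤ ((x / E i : ℕ) : ℝ) - ((x / E (i + 1) : ℕ) : ℝ) := by
        rw [sub_nonneg]; exact_mod_cast hmono
      exact mul_le_mul_of_nonneg_right (mul_le_mul_of_nonneg_left hsub (by positivity)) hnn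
  refine (norm_sum_le _ _).trans ((sum_le_sum hpiece).trans ?_)
  rw [sum_add_distrib, sum_const, card_range, nsmul_eq_mul, ← mul_sum,
    Finset.sum_range_sub' (fun i => ((x / E i : ℕ) : ℝ)) K, hE0, hEK]
  refine add_le_add le_rfl ?_
  rw [mul_assoc (A * B' * L)]
  refine mul_le_mul_of_nonneg_left ?_ (by positivity)
  refine mul_le_mul_of_nonneg_left ?_ (by positivity)
  have : (0 : ℝ) ≤ ((x / (2 * D) : ℕ) : ℝ) := Nat.cast_nonneg _
  linarith

/-! ### The type-II piece `F_U * G_U` -/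

/-- **The type-II piece of Vaughan's identity**: for `U ≥ 2`, `K ≥ 1`, `x ≤ U 2^J`, a uniform
divisor bound `τ(n) ≤ T` (`n ≤ x`, `T ≥ 1`) and the hypotheses `TypeIIBound`, `PointwiseBound`,
`‖Σ_{n ≤ x} (F_U * G_U)(n) λ(n)‖ ≤ J · [K (log x) T W (3x/U)^{1/12} x^{11/12+η} + (log x) T (B T)(x/K + x/U)]`
(dyadic blocks `d ∈ (U2^j, U2^{j+1}]`; blocks beyond `x/U` vanish because `G_U(m) = 0` for
`m ≤ U`; each remaining block by `norm_block_le` with `2D + x/D ≤ 3x/U`).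
[cite: FriedlanderIwaniecAnnals1998, §26 (26.3), Proposition 23.1] -/
theorem norm_sum_fU_gU_le (hII : TypeIIBound lam W) (hW : 0 ≤ W) {B : ℝ} (hBpt : PointwiseBound lam B)
    (hB0 : 0 ≤ B) {x U K J : ℕ} (hU : 2 ≤ U) (hK : 0 < K) (hJ : x ≤ U * 2 ^ J) {T : ℝ} (hT1 : 1 ≤ T)
    (hT : ∀ n, n ≤ x → ((Nat.divisors n).card : ℝ) ≤ T) :
    ‖∑ n ∈ Ioc 0 x, ((fU U * gU U) n : ℂ) * lam n‖ ≤
      J * (K * (Real.log x * T * (W * (3 * (x : ℝ) / U) ^ (1 / 12 : ℝ) * (x : ℝ) ^ (11 / 12 + eta))) +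
        Real.log x * T * (B * T) * ((x : ℝ) / K + (x : ℝ) / U)) := by
  have hU0 : 0 < U := by omega
  have hT0 : 0 ≤ T := zero_le_one.trans hT1
  have hlogx : 0 ≤ Real.log x := Real.log_natCast_nonneg x
  -- the inner sums
  set I : ℕ → ℂ := fun d => ∑ m ∈ Ioc 0 (x / d), ((gU U m : ℝ) : ℂ) * lam (d * m) with hI
  rw [sum_mul_conv_eq]
  -- Step 1: extend the range of `d` to `U 2^J ≥ x` (the new terms vanish: `x / d = 0`)
  have hext : ∑ d ∈ Ioc 0 x, ((fU U d : ℝ) : ℂ) * I d = ∑ d ∈ Ioc 0 (U * 2 ^ J), ((fU U d : ℝ) : ℂ) * I d := by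
    refine sum_subset (Ioc_subset_Ioc_right hJ) fun d hd hdx => ?_
    rw [mem_Ioc] at hd; rw [mem_Ioc, not_and, not_le] at hdx
    have : x / d = 0 := Nat.div_eq_of_lt (hdx hd.1)
    simp [hI, this]
  -- Step 2: drop `d ≤ U` (where `F_U = 0`) and replace `F_U` by `Λ`
  have hdrop : ∑ d ∈ Ioc 0 (U * 2 ^ J), ((fU U d : ℝ) : ℂ) * I d =
      ∑ d ∈ Ioc U (U * 2 ^ J), ((ArithmeticFunction.vonMangoldt d : ℝ) : ℂ) * I d := by
    rw [← sum_Ioc_consecutive _ (Nat.zero_le U) (Nat.le_mul_of_pos_right U (Nat.two_pow_pos J))]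
    have h0 : ∑ d ∈ Ioc 0 U, ((fU U d : ℝ) : ℂ) * I d = 0 :=
      sum_eq_zero fun d hd => by rw [mem_Ioc] at hd; rw [Vaughan.fU_apply, if_pos hd.2]; simp
    rw [h0, zero_add]
    refine sum_congr rfl fun d hd => ?_
    rw [mem_Ioc] at hd; rw [Vaughan.fU_apply, if_neg (by omega)]
  change ‖∑ d ∈ Ioc 0 x, ((fU U d : ℝ) : ℂ) * I d‖ ≤ _
  rw [hext, hdrop, Vaughan.sum_Ioc_mul_two_pow_eq_sum _ U J]
  -- Step 3: the blocks
  have hblock : ∀ j ∈ range J, ‖∑ d ∈ Ioc (U * 2 ^ j) (U * 2 ^ j + U * 2 ^ j), ((ArithmeticFunction.vonMangoldt d : ℝ) : ℂ) * I d‖ ≤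
      K * (Real.log x * T * (W * (3 * (x : ℝ) / U) ^ (1 / 12 : ℝ) * (x : ℝ) ^ (11 / 12 + eta))) +
        Real.log x * T * (B * T) * ((x : ℝ) / K + (x : ℝ) / U) := by
    intro j _
    set D := U * 2 ^ j with hD
    have hDU : U ≤ D := Nat.le_mul_of_pos_right U (Nat.two_pow_pos j)
    have hD0 : 0 < D := lt_of_lt_of_le hU0 hDU
    rw [← two_mul]
    by_cases hDx : D < x / U
    · -- a genuine block: `2D ≤ x`
      have h2D : 2 * D ≤ x := by
        have h1 : U * (D + 1) ≤ U * (x / U) := Nat.mul_le_mul_left U hDx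
        have h2 : U * (x / U) ≤ x := Nat.mul_div_le x U
        nlinarith
      have ha : ∀ d, d ≤ x → ‖((ArithmeticFunction.vonMangoldt d : ℝ) : ℂ)‖ ≤ Real.log x := by
        intro d hd
        rw [Complex.norm_real, Real.norm_of_nonneg vonMangoldt_nonneg]
        rcases Nat.eq_zero_or_pos d with rfl | hd0
        · simp [hlogx]
        · exact vonMangoldt_le_log.trans (Real.log_le_log (by exact_mod_cast hd0) (by exact_mod_cast hd))
      have hb : ∀ m, m ≤ x → ‖((gU U m : ℝ) : ℂ)‖ ≤ T := by
        intro m hm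
        rw [Complex.norm_real, Real.norm_eq_abs]
        refine (Vaughan.abs_gU_le U m).trans ?_
        rw [sigma_zero_apply]; exact hT m hm
      have hl : ∀ n, n ≤ x → ‖lam n‖ ≤ B * T := fun n hn =>
        (hBpt n).trans (mul_le_mul_of_nonneg_left (hT n hn) hB0)
      have hmain := norm_block_le hII hW hD0 h2D hK hlogx hT0 (mul_nonneg hB0 hT0)
        (fun d => ((ArithmeticFunction.vonMangoldt d : ℝ) : ℂ)) (fun m => ((gU U m : ℝ) : ℂ)) ha hb hl
      refine hmain.trans (add_le_add ?_ ?_)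
      · refine mul_le_mul_of_nonneg_left ?_ (Nat.cast_nonneg K)
        refine mul_le_mul_of_nonneg_left ?_ (mul_nonneg hlogx hT0)
        have hx0 : (0 : ℝ) ≤ x := Nat.cast_nonneg x
        have hU0' : (0 : ℝ) < U := by exact_mod_cast hU0
        have h3 : ((2 * D : ℕ) : ℝ) + ((x / D : ℕ) : ℝ) ≤ 3 * (x : ℝ) / U := by
          have h1 : ((2 * D : ℕ) : ℝ) ≤ 2 * (x : ℝ) / U := by
            rw [le_div_iff₀ hU0']
            have : 2 * D * U ≤ 2 * x := by
              have := Nat.mul_le_mul_left U hDx.le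
              have := Nat.mul_div_le x U
              nlinarith
            exact_mod_cast this
          have h2 : ((x / D : ℕ) : ℝ) ≤ (x : ℝ) / U :=
            Nat.cast_div_le.trans (div_le_div_of_nonneg_left hx0 hU0' (by exact_mod_cast hDU))
          have h12 : 2 * (x : ℝ) / U + (x : ℝ) / U = 3 * (x : ℝ) / U := by ring
          linarith
        have hη : (0 : ℝ) < 11 / 12 + eta := by rw [eta]; norm_num
        gcongr
      · refine mul_le_mul_of_nonneg_left ?_ (by positivity)
        have hK0 : (0 : ℝ) < K := by exact_mod_cast hK
        have hD0' : (0 : ℝ) < D := by exact_mod_cast hD0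
        have hU0' : (0 : ℝ) < U := by exact_mod_cast hU0
        have hx0 : (0 : ℝ) ≤ x := Nat.cast_nonneg x
        have h1 : ((D / K + 1 : ℕ) : ℝ) ≤ (D : ℝ) / K + 1 := by
          have hdk : ((D / K : ℕ) : ℝ) ≤ (D : ℝ) / K := Nat.cast_div_le
          push_cast; linarith
        have h2 : ((x / D : ℕ) : ℝ) ≤ (x : ℝ) / D := Nat.cast_div_le
        have h3 : (x : ℝ) / D ≤ (x : ℝ) / U := div_le_div_of_nonneg_left hx0 hU0' (by exact_mod_cast hDU)
        calc ((D / K + 1 : ℕ) : ℝ) * ((x / D : ℕ) : ℝ) ≤ ((D : ℝ) / K + 1) * ((x : ℝ) / D) :=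
              mul_le_mul h1 h2 (Nat.cast_nonneg _) (by positivity)
          _ = (x : ℝ) / K + (x : ℝ) / D := by field_simp
          _ ≤ (x : ℝ) / K + (x : ℝ) / U := by linarith
    · -- beyond `x/U`: every inner sum vanishes
      rw [not_lt] at hDx
      have hzero : ∑ d ∈ Ioc D (2 * D), ((ArithmeticFunction.vonMangoldt d : ℝ) : ℂ) * I d = 0 := by
        refine sum_eq_zero fun d hd => ?_
        rw [mem_Ioc] at hd
        have hxd : x / d < U := by
          rw [Nat.div_lt_iff_lt_mul (by omega)]
          have h1 := Nat.lt_div_mul_add (a := x) hU0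
          have h2 : U * (x / U + 1) ≤ U * d := Nat.mul_le_mul_left U (by omega)
          nlinarith
        have : I d = 0 := sum_eq_zero fun m hm => by
          rw [mem_Ioc] at hm
          rw [Vaughan.gU_eq_zero_of_le (by omega : m ≤ U)]; simp
        rw [this, mul_zero]
      rw [hzero, norm_zero]; positivity
  calc ‖∑ i ∈ range J, ∑ d ∈ Ioc (U * 2 ^ i) (U * 2 ^ i + U * 2 ^ i), ((ArithmeticFunction.vonMangoldt d : ℝ) : ℂ) * I d‖
      ≤ ∑ i ∈ range J, (K * (Real.log x * T * (W * (3 * (x : ℝ) / U) ^ (1 / 12 : ℝ) * (x : ℝ) ^ (11 / 12 + eta))) +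
          Real.log x * T * (B * T) * ((x : ℝ) / K + (x : ℝ) / U)) :=
        (norm_sum_le _ _).trans (sum_le_sum hblock)
    _ = J * (K * (Real.log x * T * (W * (3 * (x : ℝ) / U) ^ (1 / 12 : ℝ) * (x : ℝ) ^ (11 / 12 + eta))) +
          Real.log x * T * (B * T) * ((x : ℝ) / K + (x : ℝ) / U)) := by
        rw [sum_const, card_range, nsmul_eq_mul]

/-! ### The master bound with free parameters -/

/-- **Vaughan's identity against `λ`, all four pieces** (parameters `U ≥ 2`, `K ≥ 1`, `J` with
`x ≤ U 2^J`, a uniform divisor bound `T`): `‖Σ_{n ≤ x} Λ(n) λ(n)‖ ≤ B U³ + 2W x^{4/5} U^{6/5} log x +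
2W x^{4/5} (U²)^{6/5} log U + J [K (log x) T W (3x/U)^{1/12} x^{11/12+η} + (log x) T (BT)(x/K + x/U)]`.
[cite: FriedlanderIwaniecAnnals1998, §26 (26.1)–(26.3)] -/
theorem norm_sum_vonMangoldt_mul_le_param (hI : TypeIBound lam W) (hII : TypeIIBound lam W) (hW : 0 ≤ W)
    {B : ℝ} (hBpt : PointwiseBound lam B) (hB0 : 0 ≤ B) {x U K J : ℕ} (hU : 2 ≤ U) (hK : 0 < K)
    (hJ : x ≤ U * 2 ^ J) {T : ℝ} (hT1 : 1 ≤ T) (hT : ∀ n, n ≤ x → ((Nat.divisors n).card : ℝ) ≤ T) :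
    ‖∑ n ∈ Ioc 0 x, ((ArithmeticFunction.vonMangoldt n : ℝ) : ℂ) * lam n‖ ≤
      B * (U : ℝ) ^ 3 + 2 * W * (x : ℝ) ^ (4 / 5 : ℝ) * (U : ℝ) ^ (6 / 5 : ℝ) * Real.log x +
        2 * W * (x : ℝ) ^ (4 / 5 : ℝ) * ((U * U : ℕ) : ℝ) ^ (6 / 5 : ℝ) * Real.log U +
        J * (K * (Real.log x * T * (W * (3 * (x : ℝ) / U) ^ (1 / 12 : ℝ) * (x : ℝ) ^ (11 / 12 + eta))) +
          Real.log x * T * (B * T) * ((x : ℝ) / K + (x : ℝ) / U)) := by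
  -- Vaughan's identity pointwise
  have hΛ : ∀ n, ((ArithmeticFunction.vonMangoldt n : ℝ) : ℂ) =
      ((vonMangoldtTrunc U n : ℝ) : ℂ) +
        (((((moebiusTrunc U : ArithmeticFunction ℤ) : ArithmeticFunction ℝ) * ArithmeticFunction.log) n : ℝ) : ℂ) -
        (((cU U * (ζ : ArithmeticFunction ℝ)) n : ℝ) : ℂ) + (((fU U * gU U) n : ℝ) : ℂ) := by
    intro n
    have h := congrArg (fun F : ArithmeticFunction ℝ => F n) (vonMangoldt_eq_four_terms U)
    simp only [ArithmeticFunction.add_apply, arith_sub_apply] at h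
    rw [h]; push_cast; ring
  simp_rw [hΛ, add_mul, sub_mul, add_mul, sum_add_distrib, sum_sub_distrib, sum_add_distrib]
  have h0 := norm_sum_vonMangoldtTrunc_le hBpt hB0 x U
  have h1 := norm_sum_moebiusTrunc_log_le hI hW x U
  have h2 := norm_sum_cU_zeta_le hI hW x U
  have h3 := norm_sum_fU_gU_le hII hW hBpt hB0 hU hK hJ hT1 hT
  calc _ ≤ ‖∑ n ∈ Ioc 0 x, ((vonMangoldtTrunc U n : ℝ) : ℂ) * lam n +
          ∑ n ∈ Ioc 0 x, (((((moebiusTrunc U : ArithmeticFunction ℤ) : ArithmeticFunction ℝ) *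
            ArithmeticFunction.log) n : ℝ) : ℂ) * lam n -
          ∑ n ∈ Ioc 0 x, (((cU U * (ζ : ArithmeticFunction ℝ)) n : ℝ) : ℂ) * lam n‖ +
        ‖∑ n ∈ Ioc 0 x, (((fU U * gU U) n : ℝ) : ℂ) * lam n‖ := norm_add_le _ _
    _ ≤ (‖∑ n ∈ Ioc 0 x, ((vonMangoldtTrunc U n : ℝ) : ℂ) * lam n‖ +
          ‖∑ n ∈ Ioc 0 x, (((((moebiusTrunc U : ArithmeticFunction ℤ) : ArithmeticFunction ℝ) *
            ArithmeticFunction.log) n : ℝ) : ℂ) * lam n‖ +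
          ‖∑ n ∈ Ioc 0 x, (((cU U * (ζ : ArithmeticFunction ℝ)) n : ℝ) : ℂ) * lam n‖) +
        ‖∑ n ∈ Ioc 0 x, (((fU U * gU U) n : ℝ) : ℂ) * lam n‖ := by
        gcongr
        exact (norm_sub_le _ _).trans (add_le_add (norm_add_le _ _) le_rfl)
    _ ≤ _ := by linarith

/-! ### The prime-sum theorem: `Σ_{n ≤ x} Λ(n) λ(n) ≪ (W + B) x^{1 - 1/1000}` -/

set_option maxHeartbeats 800000 in
/-- **The engine** (the structure of the proof of Theorem 2^ψ in §26, made generic): there is an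
absolute constant `C` such that for every sequence `λ` with `|λ(n)| ≤ B τ(n)`, the type-I bound
`‖Σ_{n ≤ N} λ(dn)‖ ≤ W d N^{4/5}` and the type-II bound
`‖ΣΣ_{m ≤ M, n ≤ N} α(m)β(n)λ(mn)‖ ≤ W (M+N)^{1/12} (MN)^{11/12+η}` (`|α|, |β| ≤ 1`, `η = 10⁻⁴`), one has
`‖Σ_{n ≤ x} Λ(n) λ(n)‖ ≤ C (W + B) x^{1 - 1/1000}` for all `x ≥ 1`. (Choices: `U = ⌊x^{1/14}⌋`,
`K = ⌈U^{1/24}⌉` short intervals per dyadic block, `τ(n) ≪ n^{1/2000}`.)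
[cite: FriedlanderIwaniecAnnals1998, §26 (proof of Theorem 2^ψ from Propositions 23.1, 23.2)] -/
theorem exists_norm_sum_vonMangoldt_mul_le :
    ∃ C : ℝ, 0 < C ∧ ∀ (lam : ℕ → ℂ) (W B : ℝ), 0 ≤ W → 0 ≤ B →
      TypeIBound lam W → TypeIIBound lam W → PointwiseBound lam B →
      ∀ x : ℕ, 1 ≤ x → ‖∑ n ∈ Ioc 0 x, ((ArithmeticFunction.vonMangoldt n : ℝ) : ℂ) * lam n‖ ≤
        C * (W + B) * (x : ℝ) ^ (1 - 1 / 1000 : ℝ) := by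
  obtain ⟨Cτ, hCτ1, hCτ⟩ := Literature.NumberTheory.Sieve.exists_card_divisors_le_mul_rpow
    (ε := 1 / 2000) (by norm_num)
  -- the absolute constant
  refine ⟨10 ^ 13 * Cτ ^ 2, by positivity, ?_⟩
  intro lam W B hW hB0 hI hII hBpt x hx1
  have hCτ0 : 0 ≤ Cτ := zero_le_one.trans hCτ1
  have hx0 : (0 : ℝ) < x := by exact_mod_cast hx1
  have hx1' : (1 : ℝ) ≤ x := by exact_mod_cast hx1
  have hG1 : (1 : ℝ) ≤ (x : ℝ) ^ (1 - 1 / 1000 : ℝ) := Real.one_le_rpow hx1' (by norm_num)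
  -- uniform divisor bound on `[1, x]`
  have hτ : ∀ n, n ≤ x → ((Nat.divisors n).card : ℝ) ≤ Cτ * (x : ℝ) ^ (1 / 2000 : ℝ) := by
    intro n hn
    rcases Nat.eq_zero_or_pos n with rfl | hn0
    · simp; positivity
    · refine (hCτ n hn0.ne').trans ?_
      exact mul_le_mul_of_nonneg_left (Real.rpow_le_rpow (Nat.cast_nonneg n) (by exact_mod_cast hn) (by norm_num)) hCτ0
  by_cases hsmall : x < 16384
  · -- small `x`: the trivial bound `Σ Λ(n) |λ(n)| ≤ x · log x · B · x ≤ B x³`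
    have htriv : ‖∑ n ∈ Ioc 0 x, ((ArithmeticFunction.vonMangoldt n : ℝ) : ℂ) * lam n‖ ≤ B * (x : ℝ) ^ 3 := by
      calc ‖∑ n ∈ Ioc 0 x, ((ArithmeticFunction.vonMangoldt n : ℝ) : ℂ) * lam n‖
          ≤ ∑ n ∈ Ioc 0 x, (x : ℝ) * (B * x) := by
            refine (norm_sum_le _ _).trans (sum_le_sum fun n hn => ?_)
            rw [mem_Ioc] at hn
            have hn0 : (0 : ℝ) < n := by exact_mod_cast hn.1
            rw [norm_mul, Complex.norm_real, Real.norm_of_nonneg vonMangoldt_nonneg]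
            refine mul_le_mul ?_ ?_ (norm_nonneg _) (Nat.cast_nonneg x)
            · calc ArithmeticFunction.vonMangoldt n ≤ Real.log n := vonMangoldt_le_log
                _ ≤ n - 1 := Real.log_le_sub_one_of_pos hn0
                _ ≤ x := by
                    have h : (n : ℝ) ≤ x := by exact_mod_cast hn.2
                    linarith
            · calc ‖lam n‖ ≤ B * (Nat.divisors n).card := hBpt n
                _ ≤ B * n := by gcongr; exact_mod_cast Nat.card_divisors_le_self n
                _ ≤ B * x := by gcongr; exact_mod_cast hn.2
        _ = B * (x : ℝ) ^ 3 := by rw [sum_const, Nat.card_Ioc, Nat.sub_zero, nsmul_eq_mul]; ring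
    refine htriv.trans ?_
    have hx3 : (x : ℝ) ^ 3 ≤ 16384 ^ 3 := by
      have : (x : ℝ) ≤ 16384 := by exact_mod_cast hsmall.le
      exact pow_le_pow_left₀ (Nat.cast_nonneg x) this 3
    have hC2 : (1 : ℝ) ≤ Cτ ^ 2 := by nlinarith
    calc B * (x : ℝ) ^ 3 ≤ B * 16384 ^ 3 := mul_le_mul_of_nonneg_left hx3 hB0
      _ ≤ B * (10 ^ 13 * Cτ ^ 2) := by
          refine mul_le_mul_of_nonneg_left ?_ hB0
          nlinarith
      _ ≤ 10 ^ 13 * Cτ ^ 2 * (W + B) * 1 := by nlinarith [mul_nonneg hW (le_trans zero_le_one hC2)]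
      _ ≤ 10 ^ 13 * Cτ ^ 2 * (W + B) * (x : ℝ) ^ (1 - 1 / 1000 : ℝ) := by gcongr
  · -- large `x`
    rw [not_lt] at hsmall
    have hX : (16384 : ℝ) ≤ x := by exact_mod_cast hsmall
    -- the parameters
    set p : ℝ := (x : ℝ) ^ (1 / 14 : ℝ) with hp
    have hp2 : (2 : ℝ) ≤ p := by
      rw [hp, show (2 : ℝ) = (16384 : ℝ) ^ (1 / 14 : ℝ) by
        rw [show (16384 : ℝ) = 2 ^ (14 : ℝ) by norm_num, ← Real.rpow_mul (by norm_num)]; norm_num]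
      exact Real.rpow_le_rpow (by norm_num) hX (by norm_num)
    have hp0 : 0 < p := by linarith
    set U : ℕ := ⌊p⌋₊ with hU
    have hU2 : 2 ≤ U := Nat.le_floor (by exact_mod_cast hp2)
    have hU0 : (0 : ℝ) < U := by exact_mod_cast (by omega : 0 < U)
    have hUp : (U : ℝ) ≤ p := Nat.floor_le hp0.le
    have hpU : p ≤ 2 * U := by
      have := Nat.lt_floor_add_one p; rw [← hU] at this; linarith
    set K : ℕ := ⌈(U : ℝ) ^ (1 / 24 : ℝ)⌉₊ with hK
    have hU24 : (1 : ℝ) ≤ (U : ℝ) ^ (1 / 24 : ℝ) := Real.one_le_rpow (by exact_mod_cast (by omega : 1 ≤ U)) (by norm_num)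
    have hK1 : 1 ≤ K := Nat.one_le_ceil_iff.mpr (lt_of_lt_of_le zero_lt_one hU24) |> fun h => by
      rw [hK]; exact Nat.one_le_ceil_iff.mpr (by linarith)
    have hKle : (K : ℝ) ≤ 2 * (U : ℝ) ^ (1 / 24 : ℝ) := by
      have := Nat.ceil_lt_add_one (Real.rpow_nonneg hU0.le (1 / 24 : ℝ))
      rw [← hK] at this; linarith
    have hKge : (U : ℝ) ^ (1 / 24 : ℝ) ≤ K := Nat.le_ceil _
    set J : ℕ := Nat.log 2 x + 1 with hJ
    have h2J : x < 2 ^ J := by rw [hJ]; exact Nat.lt_pow_succ_log_self one_lt_two x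
    have hxJ : x ≤ U * 2 ^ J := h2J.le.trans (Nat.le_mul_of_pos_left (2 ^ J) (by omega : 0 < U))
    set T : ℝ := Cτ * (x : ℝ) ^ (1 / 2000 : ℝ) with hT
    have hx2000 : (1 : ℝ) ≤ (x : ℝ) ^ (1 / 2000 : ℝ) := Real.one_le_rpow hx1' (by norm_num)
    have hT1 : 1 ≤ T := by rw [hT]; nlinarith
    -- the master bound
    have hK0 : 0 < K := hK1
    have hmaster := norm_sum_vonMangoldt_mul_le_param hI hII hW hBpt hB0 hU2 hK0 hxJ hT1 hτ
    refine hmaster.trans ?_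
    -- logarithms
    set L : ℝ := Real.log x with hL
    have hL1 : 1 ≤ L := by
      rw [hL, ← Real.log_exp 1]
      refine Real.log_le_log (Real.exp_pos 1) (le_trans ?_ hX)
      have := Real.exp_one_lt_d9; norm_num at this ⊢; linarith
    have hL0 : 0 ≤ L := zero_le_one.trans hL1
    have hLle : L ≤ 4000 * (x : ℝ) ^ (1 / 4000 : ℝ) := by
      have := Real.log_le_rpow_div hx0.le (by norm_num : (0 : ℝ) < 1 / 4000)
      rw [hL]; linarith [this, show (x : ℝ) ^ (1 / 4000 : ℝ) / (1 / 4000) = 4000 * (x : ℝ) ^ (1 / 4000 : ℝ) by ring]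
    have hlogU : Real.log U ≤ L := by
      rw [hL]; refine Real.log_le_log hU0 (hUp.trans ?_)
      rw [hp]; exact Real.rpow_le_self_of_one_le hx1' (by norm_num)
    have hJle : (J : ℝ) ≤ 3 * L := by
      have h2J : ((2 ^ Nat.log 2 x : ℕ) : ℝ) ≤ x := by exact_mod_cast Nat.pow_log_le_self 2 (by omega)
      have hlog2 : Real.log 2 * (Nat.log 2 x) ≤ L := by
        have := Real.log_le_log (by positivity) h2J
        rw [Nat.cast_pow, Nat.cast_ofNat, Real.log_pow] at this
        rw [hL]; linarith
      have hl2 : (1 / 2 : ℝ) < Real.log 2 := by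
        have := Real.log_two_gt_d9; linarith
      rw [hJ]; push_cast
      nlinarith
    -- abbreviations and elementary facts about powers of `X = x`
    have eX : ∀ a b : ℝ, (x : ℝ) ^ a * (x : ℝ) ^ b = (x : ℝ) ^ (a + b) := fun a b => (Real.rpow_add hx0 a b).symm
    have mX : ∀ a b : ℝ, a ≤ b → (x : ℝ) ^ a ≤ (x : ℝ) ^ b := fun a b h => Real.rpow_le_rpow_of_exponent_le hx1' h
    have hXnn : ∀ a : ℝ, 0 ≤ (x : ℝ) ^ a := fun a => Real.rpow_nonneg hx0.le a
    set G : ℝ := (x : ℝ) ^ (1 - 1 / 1000 : ℝ) with hG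
    set e1 : ℝ := (x : ℝ) ^ (1 / 4000 : ℝ) with he1
    set e2 : ℝ := (x : ℝ) ^ (1 / 2000 : ℝ) with he2
    set m : ℝ := (x : ℝ) ^ (-(1 / 336) : ℝ) with hm
    have he1sq : e1 * e1 = e2 := by rw [he1, he2, eX]; norm_num
    have hL2 : L * L ≤ 16000000 * e2 := by
      have := mul_le_mul hLle hLle hL0 (by positivity)
      rw [show 4000 * e1 * (4000 * e1) = 16000000 * (e1 * e1) by ring, he1sq] at this; exact this
    -- `u = U^{1/24}`: `K ≤ 2u`, `u ≤ K`, `u ≤ U`, `1/u ≤ 2 m`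
    set u : ℝ := (U : ℝ) ^ (1 / 24 : ℝ) with hu
    have hu1 : 1 ≤ u := hU24
    have hu0 : 0 < u := lt_of_lt_of_le zero_lt_one hu1
    have huU : u ≤ U := by
      rw [hu]; exact Real.rpow_le_self_of_one_le (by exact_mod_cast (by omega : 1 ≤ U)) (by norm_num)
    have hp336 : p ^ (1 / 24 : ℝ) = (x : ℝ) ^ (1 / 336 : ℝ) := by
      rw [hp, ← Real.rpow_mul hx0.le]; norm_num
    have hu_lower : (x : ℝ) ^ (1 / 336 : ℝ) ≤ 2 * u := by
      -- `x^{1/336} = p^{1/24} ≤ (2U)^{1/24} ≤ 2 U^{1/24}`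
      rw [← hp336]
      calc p ^ (1 / 24 : ℝ) ≤ (2 * (U : ℝ)) ^ (1 / 24 : ℝ) := Real.rpow_le_rpow hp0.le hpU (by norm_num)
        _ = (2 : ℝ) ^ (1 / 24 : ℝ) * u := by rw [hu, Real.mul_rpow (by norm_num) hU0.le]
        _ ≤ 2 * u := by
            refine mul_le_mul_of_nonneg_right ?_ hu0.le
            calc (2 : ℝ) ^ (1 / 24 : ℝ) ≤ (2 : ℝ) ^ (1 : ℝ) := Real.rpow_le_rpow_of_exponent_le (by norm_num) (by norm_num)
              _ = 2 := Real.rpow_one 2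
    have hm_eq : m = ((x : ℝ) ^ (1 / 336 : ℝ))⁻¹ := by rw [hm, Real.rpow_neg hx0.le]
    have hx336 : 0 < (x : ℝ) ^ (1 / 336 : ℝ) := Real.rpow_pos_of_pos hx0 _
    have hu_inv : u⁻¹ ≤ 2 * m := by
      rw [hm_eq, ← div_eq_mul_inv, le_div_iff₀ hx336, inv_mul_le_iff₀ hu0]
      linarith
    have hm0 : 0 ≤ m := hXnn _
    -- T1: `B U³ ≤ B G`
    have hT1 : B * (U : ℝ) ^ 3 ≤ B * G := by
      refine mul_le_mul_of_nonneg_left ?_ hB0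
      calc (U : ℝ) ^ 3 ≤ p ^ 3 := pow_le_pow_left₀ hU0.le hUp 3
        _ = (x : ℝ) ^ (3 / 14 : ℝ) := by
            rw [hp, ← Real.rpow_natCast, ← Real.rpow_mul hx0.le]; norm_num
        _ ≤ G := mX _ _ (by norm_num)
    -- T2: `2W X^{4/5} U^{6/5} L ≤ 8000 W G`
    have hT2 : 2 * W * (x : ℝ) ^ (4 / 5 : ℝ) * (U : ℝ) ^ (6 / 5 : ℝ) * L ≤ 8000 * W * G := by
      have h1 : (U : ℝ) ^ (6 / 5 : ℝ) ≤ (x : ℝ) ^ (3 / 35 : ℝ) := by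
        calc (U : ℝ) ^ (6 / 5 : ℝ) ≤ p ^ (6 / 5 : ℝ) := Real.rpow_le_rpow hU0.le hUp (by norm_num)
          _ = (x : ℝ) ^ (3 / 35 : ℝ) := by rw [hp, ← Real.rpow_mul hx0.le]; norm_num
      have h2 : (x : ℝ) ^ (4 / 5 : ℝ) * (x : ℝ) ^ (3 / 35 : ℝ) * e1 ≤ G := by
        rw [he1, eX, eX]; exact mX _ _ (by norm_num)
      calc 2 * W * (x : ℝ) ^ (4 / 5 : ℝ) * (U : ℝ) ^ (6 / 5 : ℝ) * L
          ≤ 2 * W * (x : ℝ) ^ (4 / 5 : ℝ) * (x : ℝ) ^ (3 / 35 : ℝ) * (4000 * e1) := by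
            have h0 : 0 ≤ 2 * W * (x : ℝ) ^ (4 / 5 : ℝ) := by positivity
            calc 2 * W * (x : ℝ) ^ (4 / 5 : ℝ) * (U : ℝ) ^ (6 / 5 : ℝ) * L
                ≤ 2 * W * (x : ℝ) ^ (4 / 5 : ℝ) * (x : ℝ) ^ (3 / 35 : ℝ) * L :=
                  mul_le_mul_of_nonneg_right (mul_le_mul_of_nonneg_left h1 h0) hL0
              _ ≤ _ := mul_le_mul_of_nonneg_left hLle (by positivity)
        _ = 8000 * W * ((x : ℝ) ^ (4 / 5 : ℝ) * (x : ℝ) ^ (3 / 35 : ℝ) * e1) := by ring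
        _ ≤ 8000 * W * G := mul_le_mul_of_nonneg_left h2 (by positivity)
    -- T3: `2W X^{4/5} (U²)^{6/5} log U ≤ 8000 W G`
    have hT3 : 2 * W * (x : ℝ) ^ (4 / 5 : ℝ) * ((U * U : ℕ) : ℝ) ^ (6 / 5 : ℝ) * Real.log U ≤ 8000 * W * G := by
      have h1 : ((U * U : ℕ) : ℝ) ^ (6 / 5 : ℝ) ≤ (x : ℝ) ^ (6 / 35 : ℝ) := by
        have hUU : ((U * U : ℕ) : ℝ) ≤ p ^ (2 : ℝ) := by
          rw [Real.rpow_two, sq]; push_cast; exact mul_le_mul hUp hUp hU0.le hp0.le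
        calc ((U * U : ℕ) : ℝ) ^ (6 / 5 : ℝ) ≤ (p ^ (2 : ℝ)) ^ (6 / 5 : ℝ) :=
              Real.rpow_le_rpow (Nat.cast_nonneg _) hUU (by norm_num)
          _ = (x : ℝ) ^ (6 / 35 : ℝ) := by
              rw [hp, ← Real.rpow_mul hx0.le, ← Real.rpow_mul hx0.le]; norm_num
      have h2 : (x : ℝ) ^ (4 / 5 : ℝ) * (x : ℝ) ^ (6 / 35 : ℝ) * e1 ≤ G := by
        rw [he1, eX, eX]; exact mX _ _ (by norm_num)
      calc 2 * W * (x : ℝ) ^ (4 / 5 : ℝ) * ((U * U : ℕ) : ℝ) ^ (6 / 5 : ℝ) * Real.log U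
          ≤ 2 * W * (x : ℝ) ^ (4 / 5 : ℝ) * (x : ℝ) ^ (6 / 35 : ℝ) * (4000 * e1) := by
            have hlog4000 : Real.log U ≤ 4000 * e1 := hlogU.trans hLle
            have hlog0 : 0 ≤ Real.log U := Real.log_natCast_nonneg U
            have h0 : 0 ≤ 2 * W * (x : ℝ) ^ (4 / 5 : ℝ) := by positivity
            calc 2 * W * (x : ℝ) ^ (4 / 5 : ℝ) * ((U * U : ℕ) : ℝ) ^ (6 / 5 : ℝ) * Real.log U
                ≤ 2 * W * (x : ℝ) ^ (4 / 5 : ℝ) * (x : ℝ) ^ (6 / 35 : ℝ) * Real.log U :=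
                  mul_le_mul_of_nonneg_right (mul_le_mul_of_nonneg_left h1 h0) hlog0
              _ ≤ _ := mul_le_mul_of_nonneg_left hlog4000 (by positivity)
        _ = 8000 * W * ((x : ℝ) ^ (4 / 5 : ℝ) * (x : ℝ) ^ (6 / 35 : ℝ) * e1) := by ring
        _ ≤ 8000 * W * G := mul_le_mul_of_nonneg_left h2 (by positivity)
    -- the factor `K (3X/U)^{1/12} ≤ 8 X^{1/12} m`
    have hKfac : (K : ℝ) * (3 * (x : ℝ) / U) ^ (1 / 12 : ℝ) ≤ 8 * (x : ℝ) ^ (1 / 12 : ℝ) * m := by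
      have h3 : (3 * (x : ℝ) / U) ^ (1 / 12 : ℝ) = (3 : ℝ) ^ (1 / 12 : ℝ) * (x : ℝ) ^ (1 / 12 : ℝ) / (u * u) := by
        rw [Real.div_rpow (by positivity) hU0.le, Real.mul_rpow (by norm_num) hx0.le]
        congr 1
        rw [hu, ← Real.rpow_add hU0]; norm_num
      have h312 : (3 : ℝ) ^ (1 / 12 : ℝ) ≤ 2 := by
        calc (3 : ℝ) ^ (1 / 12 : ℝ) ≤ (3 : ℝ) ^ (1 / 2 : ℝ) := Real.rpow_le_rpow_of_exponent_le (by norm_num) (by norm_num)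
          _ ≤ 2 := by
              rw [← Real.sqrt_eq_rpow]
              exact Real.sqrt_le_iff.mpr ⟨by norm_num, by norm_num⟩
      rw [h3]
      calc (K : ℝ) * ((3 : ℝ) ^ (1 / 12 : ℝ) * (x : ℝ) ^ (1 / 12 : ℝ) / (u * u))
          ≤ (2 * u) * (2 * (x : ℝ) ^ (1 / 12 : ℝ) / (u * u)) := by
            refine mul_le_mul hKle ?_ (by positivity) (by positivity)
            exact div_le_div_of_nonneg_right (mul_le_mul_of_nonneg_right h312 (hXnn _)) (by positivity)
        _ = 4 * (x : ℝ) ^ (1 / 12 : ℝ) * u⁻¹ := by field_simp; ring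
        _ ≤ 4 * (x : ℝ) ^ (1 / 12 : ℝ) * (2 * m) := mul_le_mul_of_nonneg_left hu_inv (by positivity)
        _ = _ := by ring
    -- T4: `J K L T W (3X/U)^{1/12} X^{11/12+η} ≤ 10⁹ Cτ W G`
    have hT0 : 0 ≤ T := by linarith
    have hT4 : (J : ℝ) * ((K : ℝ) * (L * T * (W * (3 * (x : ℝ) / U) ^ (1 / 12 : ℝ) * (x : ℝ) ^ (11 / 12 + eta)))) ≤
        10 ^ 9 * Cτ * W * G := by
      have hmono : (x : ℝ) ^ (1 / 12 : ℝ) * m * e2 * e2 * (x : ℝ) ^ (11 / 12 + eta) ≤ G := by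
        rw [hm, he2, eX, eX, eX, eX, eta]; exact mX _ _ (by norm_num)
      have hP : 0 ≤ (x : ℝ) ^ (11 / 12 + eta) := hXnn _
      have hF0 : 0 ≤ (K : ℝ) * (3 * (x : ℝ) / U) ^ (1 / 12 : ℝ) := by positivity
      have hA : (J : ℝ) * L * T * W ≤ 3 * L * L * T * W :=
        mul_le_mul_of_nonneg_right (mul_le_mul_of_nonneg_right (mul_le_mul_of_nonneg_right hJle hL0) hT0) hW
      have h3L : (0 : ℝ) ≤ 3 * L := by linarith
      have hA0 : 0 ≤ 3 * L * L * T * W := mul_nonneg (mul_nonneg (mul_nonneg h3L hL0) hT0) hW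
      calc (J : ℝ) * ((K : ℝ) * (L * T * (W * (3 * (x : ℝ) / U) ^ (1 / 12 : ℝ) * (x : ℝ) ^ (11 / 12 + eta))))
          = (J * L * T * W) * ((K : ℝ) * (3 * (x : ℝ) / U) ^ (1 / 12 : ℝ)) * (x : ℝ) ^ (11 / 12 + eta) := by ring
        _ ≤ (3 * L * L * T * W) * (8 * (x : ℝ) ^ (1 / 12 : ℝ) * m) * (x : ℝ) ^ (11 / 12 + eta) :=
            mul_le_mul_of_nonneg_right (mul_le_mul hA hKfac hF0 hA0) hP
        _ = 24 * (L * L) * (T * W * ((x : ℝ) ^ (1 / 12 : ℝ) * m) * (x : ℝ) ^ (11 / 12 + eta)) := by ring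
        _ ≤ 24 * (16000000 * e2) * (T * W * ((x : ℝ) ^ (1 / 12 : ℝ) * m) * (x : ℝ) ^ (11 / 12 + eta)) := by
            refine mul_le_mul_of_nonneg_right (mul_le_mul_of_nonneg_left hL2 (by norm_num)) ?_
            exact mul_nonneg (mul_nonneg (mul_nonneg hT0 hW) (mul_nonneg (hXnn _) hm0)) hP
        _ = 384000000 * Cτ * W * ((x : ℝ) ^ (1 / 12 : ℝ) * m * e2 * e2 * (x : ℝ) ^ (11 / 12 + eta)) := by
            rw [hT]; ring
        _ ≤ 384000000 * Cτ * W * G := mul_le_mul_of_nonneg_left hmono (by positivity)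
        _ ≤ 10 ^ 9 * Cτ * W * G := by
            have : 0 ≤ Cτ * W * G := by positivity
            linarith
    -- T5: `J L T (B T) (X/K + X/U) ≤ 10⁹ Cτ² B G`
    have hT5 : (J : ℝ) * (L * T * (B * T) * ((x : ℝ) / K + (x : ℝ) / U)) ≤ 10 ^ 9 * Cτ ^ 2 * B * G := by
      have hK0' : (0 : ℝ) < K := lt_of_lt_of_le hu0 hKge
      have hfrac : (x : ℝ) / K + (x : ℝ) / U ≤ 4 * ((x : ℝ) * m) := by
        have h1 : (x : ℝ) / K ≤ (x : ℝ) * u⁻¹ := by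
          rw [div_eq_mul_inv]; exact mul_le_mul_of_nonneg_left ((inv_le_inv₀ hK0' hu0).mpr hKge) hx0.le
        have h2 : (x : ℝ) / U ≤ (x : ℝ) * u⁻¹ := by
          rw [div_eq_mul_inv]; exact mul_le_mul_of_nonneg_left ((inv_le_inv₀ hU0 hu0).mpr huU) hx0.le
        have h3 : (x : ℝ) * u⁻¹ ≤ (x : ℝ) * (2 * m) := mul_le_mul_of_nonneg_left hu_inv hx0.le
        linarith
      have hxm : (x : ℝ) * m = (x : ℝ) ^ (1 - 1 / 336 : ℝ) := by
        rw [hm, show (1 - 1 / 336 : ℝ) = 1 + (-(1 / 336)) by norm_num, Real.rpow_add hx0, Real.rpow_one]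
      have hmono : e2 * e2 * e2 * ((x : ℝ) * m) ≤ G := by
        rw [hxm, he2, eX, eX, eX]
        exact mX _ _ (by norm_num)
      have hfr0 : 0 ≤ (x : ℝ) / K + (x : ℝ) / U := by positivity
      have hTT : 0 ≤ T * T := mul_nonneg hT0 hT0
      have hA : (J : ℝ) * L * (T * T) * B ≤ 3 * L * L * (T * T) * B :=
        mul_le_mul_of_nonneg_right (mul_le_mul_of_nonneg_right (mul_le_mul_of_nonneg_right hJle hL0) hTT) hB0
      have h3L : (0 : ℝ) ≤ 3 * L := by linarith
      have hA0 : 0 ≤ 3 * L * L * (T * T) * B := mul_nonneg (mul_nonneg (mul_nonneg h3L hL0) hTT) hB0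
      calc (J : ℝ) * (L * T * (B * T) * ((x : ℝ) / K + (x : ℝ) / U))
          = J * L * (T * T) * B * ((x : ℝ) / K + (x : ℝ) / U) := by ring
        _ ≤ (3 * L * L * (T * T) * B) * (4 * ((x : ℝ) * m)) := mul_le_mul hA hfrac hfr0 hA0
        _ = 12 * (L * L) * ((T * T) * B * ((x : ℝ) * m)) := by ring
        _ ≤ 12 * (16000000 * e2) * ((T * T) * B * ((x : ℝ) * m)) := by
            refine mul_le_mul_of_nonneg_right (mul_le_mul_of_nonneg_left hL2 (by norm_num)) ?_
            exact mul_nonneg (mul_nonneg (mul_nonneg hT0 hT0) hB0) (mul_nonneg hx0.le hm0)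
        _ = 192000000 * Cτ ^ 2 * B * (e2 * e2 * e2 * ((x : ℝ) * m)) := by rw [hT]; ring
        _ ≤ 192000000 * Cτ ^ 2 * B * G := mul_le_mul_of_nonneg_left hmono (by positivity)
        _ ≤ 10 ^ 9 * Cτ ^ 2 * B * G := by
            have : 0 ≤ Cτ ^ 2 * B * G := by positivity
            linarith
    -- putting everything together
    have hC1 : Cτ ≤ Cτ ^ 2 := by rw [sq]; exact le_mul_of_one_le_right hCτ0 hCτ1
    have hC2 : (1 : ℝ) ≤ Cτ ^ 2 := one_le_pow₀ hCτ1
    have hWG : 0 ≤ W * G := by positivity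
    have hBG : 0 ≤ B * G := by positivity
    have hsum : B * (U : ℝ) ^ 3 + 2 * W * (x : ℝ) ^ (4 / 5 : ℝ) * (U : ℝ) ^ (6 / 5 : ℝ) * Real.log x +
        2 * W * (x : ℝ) ^ (4 / 5 : ℝ) * ((U * U : ℕ) : ℝ) ^ (6 / 5 : ℝ) * Real.log U +
        J * (K * (Real.log x * T * (W * (3 * (x : ℝ) / U) ^ (1 / 12 : ℝ) * (x : ℝ) ^ (11 / 12 + eta))) +
          Real.log x * T * (B * T) * ((x : ℝ) / K + (x : ℝ) / U)) ≤
        B * G + 8000 * W * G + 8000 * W * G + 10 ^ 9 * Cτ * W * G + 10 ^ 9 * Cτ ^ 2 * B * G := by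
      rw [mul_add (J : ℝ)]
      rw [← hL] at *
      linarith [hT1, hT2, hT3, hT4, hT5]
    refine hsum.trans ?_
    have ha : B * G ≤ Cτ ^ 2 * B * G := by
      have := mul_le_mul_of_nonneg_right hC2 hBG; linarith [this]
    have hb : W * G ≤ Cτ ^ 2 * W * G := by
      have := mul_le_mul_of_nonneg_right hC2 hWG; linarith [this]
    have hc : Cτ * W * G ≤ Cτ ^ 2 * W * G := by
      have := mul_le_mul_of_nonneg_right hC1 hWG; linarith [this]
    have hpos1 : 0 ≤ Cτ ^ 2 * W * G := by positivity
    have hpos2 : 0 ≤ Cτ ^ 2 * B * G := by positivity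
    linarith

end

end Literature.NumberTheory.Sieve.FriedlanderIwaniecPrimes.PrimeSumEngine
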